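import Summits.RiemannHypothesis.RiemannHypothesis.Theses.WeilComb
import Summits.RiemannHypothesis.RiemannHypothesis.Theorems.WeilCombCombShapePositivityStubOffdiagSchur
import Summits.RiemannHypothesis.RiemannHypothesis.Theorems.WeilCombCombShapePositivityStubPoincareEta
import Summits.RiemannHypothesis.RiemannHypothesis.Theorems.WeilCombCombShapePositivityStubArchBathtub
import Summits.RiemannHypothesis.RiemannHypothesis.Theorems.WeilCombCombShapePositivityHelsonPotentialLegendre
import Summits.RiemannHypothesis.RiemannHypothesis.Theorems.WeilCombCombShapePositivityAssembleInv25
import Summits.RiemannHypothesis.RiemannHypothesis.Theorems.WeilCombCombShapePositivityStubSubDiagPole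
import Summits.RiemannHypothesis.RiemannHypothesis.Theorems.WeilCombCombShapePositivityExactPrimeWindow
import Summits.RiemannHypothesis.RiemannHypothesis.Theorems.WeilCombCombShapePositivityPolarExact
import Summits.RiemannHypothesis.RiemannHypothesis.Theorems.WeilCombCombShapePositivityArchGram
import Summits.RiemannHypothesis.RiemannHypothesis.Theorems.WeilCombCombShapePositivityWindowDichotomy
import Summits.RiemannHypothesis.RiemannHypothesis.Theorems.WeilCombCombShapeAdmissible
import Summits.RiemannHypothesis.RiemannHypothesis.Theorems.WeilCombCombSubcriticalStubIdentity
import Summits.RiemannHypothesis.RiemannHypothesis.Theorems.WeilCombCombSubcriticalEffectiveAux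
import Literature.NumberTheory.LFunctions.WeilExplicit
import Literature.NumberTheory.LFunctions.WeilGroundEnergyProofs
import Mathlib.NumberTheory.Harmonic.Bounds

/-!
# Effective window `εM ≤ 1/25` for the fixed-shape comb (Theorem B below the band), and the budget-to-window glue
(crux `WeilComb.CombShapePositivity`, item stmt-RiemannHypothesis-11229, line `Sketch`)

**Theorem** (`combShapePositivity_of_mul_le_inv_25`; corollary `stub_windowSub40` = the skeleton's glued
sub-theorem at `εM ≤ 1/40`). For every `ε > 0`, `M : ℕ`, `a : ℕ → ℂ` with `ε·M ≤ 1/25` the fixed-shape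
log-integer comb `g = Σ_{m ≤ M} a_m φ_ε(· − log m)`, `φ_ε(t) = ε⁻¹ φ₀(t/ε)`, `φ₀(u) = expNegInvGlue (1 − u²)`,
satisfies `0 ≤ Re W(g ⋆ g̃)` — unconditionally (the previous banked window was `εM ≤ 1/128`,
`combShapePositivity_of_mul_le_inv_128`).

Notation. `N = ‖φ₀‖₂²`, `I₀ = ∫ φ₀`, `U = ε⁻¹N = ψ_ε(0)`, `L = Σ‖a_m‖²`, `λ = εM`,
`H(a) = 2 Re Σ_m Σ_{n ≤ M/m} Λ(n) n^{-1/2} a(nm) conj a(m)` (Helson form),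
`V(a) = Σ ‖a_m‖² (log m + ψ₁(M/m))`, `D(a) = Σ_m Σ_{n ≤ M/m} Λ(n)‖a(nm) − n^{-1/2}a(m)‖²`,
`Q' = Σ m log m ‖a_m‖²`, `Q₁ = Σ m ‖a_m‖²`, `A∓ = Σ a_m m^{∓1/2}`,
`Off = Re Σ_{m ≠ m'} a_m conj a_{m'} W_∞(τ_{log m − log m'} ψ_ε)`, `Wd = Re W_∞(ψ_ε)`.

Proof (zeros-free explicit-formula bookkeeping). On the window (`M ≥ 1`, `2ε(M+1) ≤ 1`):
`Re Q = Re P − U·H + (L·Wd + Off)` (exact window identity p90904, polar identity p91841, archimedean Gram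
form p91497), `H = V − D` (`WeilCombSubcritical.stub_identity`); the one-sided inputs are the LANDED stubs of
the line: weighted-Schur off-diagonal bound `stub_offdiagSchur` (p109602), multiscale Poincaré inequality
`stub_poincareEta` (p109896), bathtub bound for the archimedean diagonal `stub_archBathtub` (p110455), Helson
potential `V ≤ (log M + 3/20)L` (`helsonPotential_le_three_twentieths`, p113016), pole by Cauchy–Schwarz
(`‖A₋‖² ≤ (1 + log M)L`, `‖A₊‖² ≤ M Q₁`, `|φ̂_ε(0)|,|φ̂_ε(1)| ≤ e^{ε/2} I₀`, `I₀² ≤ 2N` from `stub_subDiagPole`),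
`(log M + 1)Q₁ ≤ Q' + ML`; and the pure-arithmetic budget `assemble_inv25` (p113115) closes `0 ≤ Re Q` at
`λ ≤ 1/25`.

The glue is stated ONCE for a general threshold `λ₀ ≤ 1/8`, bump ratio `r` (`I₀² ≤ rN`) and Helson constant `G`
(`effectiveWindow_of_budget`): any sharper arithmetic budget of the same shape (e.g. `assemble_inv20`,
`assemble_inv19` with the certified ratio `153/100`) upgrades the window by a one-line specialisation.
-/

noncomputable section

-- the sub-problem path `RiemannHypothesis/RiemannHypothesis` (single-conjunct summit, D-0017) duplicates a namespace
set_option linter.dupNamespace false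

open scoped BigOperators ComplexConjugate
open Complex MeasureTheory

namespace Summit.RiemannHypothesis.RiemannHypothesis.Theorems.WeilCombBohrFejer

open Literature.NumberTheory.LFunctions

/-- `weilNorm1 φ₀ = ∫ φ₀` (the bump is real and nonnegative). [folklore] -/
private theorem weilNorm1_shapeBump_effWin :
    weilNorm1 (fun u : ℝ => ((expNegInvGlue (1 - u ^ 2) : ℝ) : ℂ)) = ∫ u : ℝ, expNegInvGlue (1 - u ^ 2) := by
  unfold weilNorm1
  congr 1 with u
  rw [Complex.norm_real, Real.norm_eq_abs, abs_of_nonneg (expNegInvGlue.nonneg _)]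

/-- `I₀ = ∫ φ₀ > 0`. [folklore] -/
private theorem integral_shapeBump_pos_effWin : 0 < ∫ u : ℝ, expNegInvGlue (1 - u ^ 2) := by
  have hc : Continuous fun u : ℝ => expNegInvGlue (1 - u ^ 2) :=
    (expNegInvGlue.contDiff (n := 0)).continuous.comp (continuous_const.sub (continuous_id.pow 2))
  have hs : HasCompactSupport fun u : ℝ => expNegInvGlue (1 - u ^ 2) := by
    refine HasCompactSupport.of_support_subset_isCompact (isCompact_Icc (a := -1) (b := 1)) ?_
    intro u hu
    by_contra h
    apply hu
    have h1 : 1 - u ^ 2 ≤ 0 := by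
      simp only [Set.mem_Icc, not_and_or, not_le] at h
      rcases h with h | h <;> nlinarith
    exact expNegInvGlue.zero_of_nonpos h1
  exact hc.integral_pos_of_hasCompactSupport_nonneg_nonzero hs (fun u => expNegInvGlue.nonneg _) (x := 0)
    (expNegInvGlue.pos_of_pos (by norm_num)).ne'

/-- `Σ_{m ≤ M} 1/m ≤ 1 + log M` (real form of `harmonic_le_one_add_log`). [folklore] -/
private theorem sum_Icc_inv_le_effWin (M : ℕ) :
    ∑ m ∈ Finset.Icc 1 M, ((m : ℝ))⁻¹ ≤ 1 + Real.log M := by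
  have hH := harmonic_le_one_add_log M
  simp_rw [harmonic_eq_sum_Icc, Rat.cast_sum, Rat.cast_inv, Rat.cast_natCast] at hH
  exact hH

/-- **Budget-to-window glue (Theorem B's effective window, abstract threshold).** Let `λ₀ ≤ 1/8`, let `r` bound
the bump ratio (`I₀² ≤ r‖φ₀‖₂²`) and `G` the Helson-potential constant (`V ≤ (log M + G)L` for all `M`, `a`).
If the pure-arithmetic budget of the window holds at `(λ₀, r, G)` — i.e. the listed one-sided bounds (exact window
identity, Helson identity, pole by Cauchy–Schwarz, bathtub diagonal, weighted-Schur off-diagonal,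
`(log M + 1)Q₁ ≤ Q' + ML`, multiscale Poincaré) imply `0 ≤ Re Q` for all reals — then the fixed-shape comb has
`0 ≤ Re W(g ⋆ g̃)` whenever `εM ≤ λ₀`. (`M = 0`: `Q(0) = 0`; `M ≥ 1`: `ε ≤ λ₀ ≤ 1/8` gives the window
`2ε(M+1) ≤ 1`, `(e^{4ε} − 1)M < 2`, `2ε < log(1 + 1/M)` and `2I₀² ≤ 4N ≤ πε⁻¹N`.) -/
theorem effectiveWindow_of_budget {lam0 r G : ℝ} (hlam0 : lam0 ≤ 1 / 8)
    (hI2r : (∫ u : ℝ, expNegInvGlue (1 - u ^ 2)) ^ 2 ≤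
      r * weilNorm2Sq (fun u : ℝ => ((expNegInvGlue (1 - u ^ 2) : ℝ) : ℂ)))
    (hG : ∀ (M : ℕ) (a : ℕ → ℂ),
      ∑ m ∈ Finset.Icc 1 M, ‖a m‖ ^ 2 *
          (Real.log m + ∑ n ∈ Finset.Icc 1 (M / m), (ArithmeticFunction.vonMangoldt n : ℝ) / n) ≤
        (Real.log M + G) * ∑ m ∈ Finset.Icc 1 M, ‖a m‖ ^ 2)
    (budget : ∀ {ε Mr N I L D Qp Q1 V H ReQ ReP Wd Off F0 F1 nAm nAp : ℝ},
      0 < ε → 1 ≤ Mr → ε * Mr ≤ lam0 →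
      0 < N → 0 < I → I ^ 2 ≤ r * N →
      0 ≤ L → 0 ≤ D → 0 ≤ Q1 →
      (Real.log Mr + 1) * Q1 ≤ Qp + Mr * L →
      (∀ η : ℝ, 0 < η → Qp ≤ (1 + η) * Mr * D + (1 + 1 / η) * (23 / 20) * Mr * L) →
      V ≤ (Real.log Mr + G) * L → H = V - D →
      ReQ = ReP - ε⁻¹ * N * H + (L * Wd + Off) →
      0 ≤ F1 → F0 ≤ Real.exp (ε / 2) * I → F1 ≤ Real.exp (ε / 2) * I →
      0 ≤ nAm → 0 ≤ nAp → nAm ^ 2 ≤ (1 + Real.log Mr) * L → nAp ^ 2 ≤ Mr * Q1 →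
      -(2 * (F0 * F1 * (nAm * nAp))) ≤ ReP →
      ε⁻¹ * N * (Real.log (ε⁻¹ * N / (2 * I ^ 2)) - 1) - 21 / (5 * Real.pi) * I ^ 2 ≤ Wd →
      -(I ^ 2 * Real.exp ε * (1 - (Real.exp (4 * ε) - 1) * Mr / 2)⁻¹ * (1 + Real.log Mr) * Q1) ≤ Off →
      0 ≤ ReQ) :
    ∀ ε : ℝ, 0 < ε → ∀ (M : ℕ) (a : ℕ → ℂ), ε * M ≤ lam0 →
      0 ≤ (weilQuadratic (fun x : ℝ => ∑ m ∈ Finset.Icc 1 M,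
        a m * ((ε : ℂ)⁻¹ * ((expNegInvGlue (1 - ((x - Real.log (m : ℝ)) / ε) ^ 2) : ℝ) : ℂ)))).re := by
  intro ε hε M a hlam
  rcases Nat.eq_zero_or_pos M with hM0 | hMpos
  · subst hM0
    have h0 : (fun x : ℝ => ∑ m ∈ Finset.Icc 1 0,
        a m * ((ε : ℂ)⁻¹ * ((expNegInvGlue (1 - ((x - Real.log (m : ℝ)) / ε) ^ 2) : ℝ) : ℂ))) = 0 := by
      funext x
      simp
    rw [h0, weilQuadratic_zero]
    simp
  have hM : 1 ≤ M := hMpos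
  have hMr : (1 : ℝ) ≤ (M : ℝ) := by exact_mod_cast hM
  have hMr0 : (0 : ℝ) < (M : ℝ) := by linarith
  have hlam8 : ε * M ≤ 1 / 8 := hlam.trans hlam0
  have hε8 : ε ≤ 1 / 8 := by nlinarith
  have hw : 2 * ε * ((M : ℝ) + 1) ≤ 1 := by nlinarith
  -- names
  set φε : ℝ → ℂ := fun t : ℝ => (ε : ℂ)⁻¹ * ((expNegInvGlue (1 - (t / ε) ^ 2) : ℝ) : ℂ) with hφε
  set ψε : ℝ → ℂ := weilConv φε (weilReflect φε) with hψε
  set N : ℝ := weilNorm2Sq (fun u : ℝ => ((expNegInvGlue (1 - u ^ 2) : ℝ) : ℂ)) with hN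
  set I : ℝ := ∫ u : ℝ, expNegInvGlue (1 - u ^ 2) with hI
  set L : ℝ := ∑ m ∈ Finset.Icc 1 M, ‖a m‖ ^ 2 with hL
  set H : ℝ := 2 * (∑ m ∈ Finset.Icc 1 M, ∑ n ∈ Finset.Icc 1 (M / m),
      ((ArithmeticFunction.vonMangoldt n : ℝ) : ℂ) / (Real.sqrt n : ℂ) * a (n * m) *
        conj (a m)).re with hH
  set V : ℝ := ∑ m ∈ Finset.Icc 1 M, ‖a m‖ ^ 2 *
      (Real.log m + ∑ n ∈ Finset.Icc 1 (M / m), (ArithmeticFunction.vonMangoldt n : ℝ) / n) with hV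
  set D : ℝ := ∑ m ∈ Finset.Icc 1 M, ∑ n ∈ Finset.Icc 1 (M / m),
      (ArithmeticFunction.vonMangoldt n : ℝ) * ‖a (n * m) - ((Real.sqrt n : ℂ))⁻¹ * a m‖ ^ 2 with hD
  set Qp : ℝ := ∑ m ∈ Finset.Icc 1 M, (m : ℝ) * Real.log m * ‖a m‖ ^ 2 with hQp
  set Q1 : ℝ := ∑ m ∈ Finset.Icc 1 M, (m : ℝ) * ‖a m‖ ^ 2 with hQ1
  set Aminus : ℂ := ∑ m ∈ Finset.Icc 1 M, a m * ((Real.sqrt (m : ℝ) : ℝ) : ℂ)⁻¹ with hAminus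
  set Aplus : ℂ := ∑ m ∈ Finset.Icc 1 M, a m * ((Real.sqrt (m : ℝ) : ℝ) : ℂ) with hAplus
  set F0 : ℝ := ‖weilMellin φε 0‖ with hF0
  set F1 : ℝ := ‖weilMellin φε 1‖ with hF1
  set Wd : ℝ := (weilArchTerm ψε).re with hWd
  set Off : ℝ := (∑ m ∈ Finset.Icc 1 M, ∑ m' ∈ (Finset.Icc 1 M).erase m,
      a m * conj (a m') * weilArchTerm (weilTranslate ψε (Real.log (m : ℝ) - Real.log (m' : ℝ)))).re
    with hOff
  -- basic facts on the bump
  have hφ : IsWeilTest (fun u : ℝ => ((expNegInvGlue (1 - u ^ 2) : ℝ) : ℂ)) :=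
    Summit.RiemannHypothesis.RiemannHypothesis.Theorems.weilComb_shapeBump_isWeilTest
  have hNpos : 0 < N := weilNorm2Sq_shapeBump_pos
  have hIpos : 0 < I := integral_shapeBump_pos_effWin
  obtain ⟨-, hcoef, hI2⟩ := stub_subDiagPole
  obtain ⟨hF0le, hF1le⟩ := hcoef ε hε
  -- the Weil test `φ_ε`, its norms
  have hφεW : IsWeilTest φε := isWeilTest_dil hφ hε.ne'
  have hn2 : weilNorm2Sq φε = ε⁻¹ * N := by
    rw [hφε, hN]
    exact weilNorm2Sq_dil (fun u : ℝ => ((expNegInvGlue (1 - u ^ 2) : ℝ) : ℂ)) hε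
  have hn1 : weilNorm1 φε = I := by
    rw [hφε, hI, ← weilNorm1_shapeBump_effWin]
    exact weilNorm1_dil (fun u : ℝ => ((expNegInvGlue (1 - u ^ 2) : ℝ) : ℂ)) hε
  -- Step 1: exact window identity, polar identity, archimedean Gram form, Helson identity
  have h1 := weilQuadratic_comb_re_exactWindow ε hε M a hM hw
  have h2 := weilPolarTerm_comb_re ε hε M a
  have h3 := weilArchTerm_comb_eq_sum ε hε M a
  have hId := Summit.RiemannHypothesis.RiemannHypothesis.Theorems.WeilCombSubcritical.stub_identity M a
  -- Step 2: the analytic stubs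
  have hexp4 : (Real.exp (4 * ε) - 1) * M < 2 := by
    have hx : 4 * ε ≤ 1 / 2 := by linarith
    have he : Real.exp (4 * ε) ≤ 1 + 4 * ε + (4 * ε) ^ 2 := by
      have h0 : |4 * ε| ≤ 1 := by
        rw [abs_of_pos (by positivity)]
        linarith
      have h' := (abs_le.1 (Real.abs_exp_sub_one_sub_id_le h0)).2
      linarith
    have h4M : 4 * ε * M ≤ 1 / 2 := by
      have : 4 * ε * (M : ℝ) = 4 * (ε * M) := by ring
      rw [this]
      linarith
    have hA : (Real.exp (4 * ε) - 1) * M ≤ (4 * ε + (4 * ε) ^ 2) * M :=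
      mul_le_mul_of_nonneg_right (by linarith) hMr0.le
    have hB : (4 * ε + (4 * ε) ^ 2) * (M : ℝ) = 4 * ε * M + 4 * ε * (4 * ε * M) := by ring
    have hC : 4 * ε * (4 * ε * M) ≤ 4 * ε * (1 / 2) := mul_le_mul_of_nonneg_left h4M (by positivity)
    linarith
  have hlog : 2 * ε < Real.log (1 + 1 / (M : ℝ)) := by
    have hx : 0 < 1 / (M : ℝ) := by positivity
    -- `log(1 + x) ≥ x/(1+x) = 1/(M+1) > 2ε`
    have h1' : 1 / ((M : ℝ) + 1) ≤ Real.log (1 + 1 / (M : ℝ)) := by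
      have := Real.one_sub_inv_le_log_of_pos (x := 1 + 1 / (M : ℝ)) (by positivity)
      have e : 1 - (1 + 1 / (M : ℝ))⁻¹ = 1 / ((M : ℝ) + 1) := by
        field_simp
        ring
      linarith [e ▸ this]
    have h2' : 2 * ε < 1 / ((M : ℝ) + 1) := by
      rw [lt_div_iff₀ (by positivity)]
      nlinarith
    linarith
  have hOff' := stub_offdiagSchur ε hε M a hM hexp4 hlog
  have hPoinc := stub_poincareEta M a
  have hV' := hG M a
  have hbath : ε⁻¹ * N * (Real.log (ε⁻¹ * N / (2 * I ^ 2)) - 1) - 21 / (5 * Real.pi) * I ^ 2 ≤ Wd := by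
    have hn1pos : 0 < weilNorm1 φε := by rw [hn1]; exact hIpos
    have hcond : 2 * weilNorm1 φε ^ 2 ≤ Real.pi * weilNorm2Sq φε := by
      rw [hn1, hn2]
      -- `2 I² ≤ 4N ≤ π N/ε` since `ε ≤ 1/8`
      have hπ : (3 : ℝ) < Real.pi := Real.pi_gt_three
      have hinv : (8 : ℝ) ≤ ε⁻¹ := by
        rw [le_inv_comm₀ (by norm_num) hε]
        linarith
      have hI2' : I ^ 2 ≤ 2 * N := hI2
      have hπε : (3 : ℝ) * 8 ≤ Real.pi * ε⁻¹ := mul_le_mul hπ.le hinv (by norm_num) (by positivity)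
      have h4 : (3 : ℝ) * 8 * N ≤ Real.pi * ε⁻¹ * N := mul_le_mul_of_nonneg_right hπε hNpos.le
      have e4 : Real.pi * (ε⁻¹ * N) = Real.pi * ε⁻¹ * N := by ring
      rw [e4]
      linarith
    have h := stub_archBathtub φε hφεW hn1pos hcond
    rw [hn1, hn2] at h
    rw [hWd, hψε]
    exact h
  -- Step 3: the polar bound `Re P ≥ −2 F0 F1 ‖A₋‖ ‖A₊‖` and the Cauchy–Schwarz bounds on `A∓`
  have hP : -(2 * (F0 * F1 * (‖Aminus‖ * ‖Aplus‖))) ≤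
      2 * (weilMellin φε 0 * conj (weilMellin φε 1) * (Aminus * conj Aplus)).re := by
    have hn : ‖weilMellin φε 0 * conj (weilMellin φε 1) * (Aminus * conj Aplus)‖ =
        F0 * F1 * (‖Aminus‖ * ‖Aplus‖) := by
      rw [norm_mul, norm_mul, norm_mul, Complex.norm_conj, Complex.norm_conj]
    have h := Complex.abs_re_le_norm (weilMellin φε 0 * conj (weilMellin φε 1) * (Aminus * conj Aplus))
    rw [hn] at h
    have := (abs_le.1 h).1
    linarith
  have hnAm2 : ‖Aminus‖ ^ 2 ≤ (1 + Real.log M) * L := by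
    have hle : ‖Aminus‖ ≤ ∑ m ∈ Finset.Icc 1 M, ‖a m‖ * (Real.sqrt (m : ℝ))⁻¹ := by
      rw [hAminus]
      refine (norm_sum_le _ _).trans (le_of_eq (Finset.sum_congr rfl fun m hm => ?_))
      rw [norm_mul, norm_inv, Complex.norm_real, Real.norm_eq_abs, abs_of_nonneg (Real.sqrt_nonneg _)]
    have hcs := Finset.sum_mul_sq_le_sq_mul_sq (Finset.Icc 1 M) (fun m => ‖a m‖)
      (fun m => (Real.sqrt (m : ℝ))⁻¹)
    have hsq : ∑ m ∈ Finset.Icc 1 M, ((Real.sqrt (m : ℝ))⁻¹) ^ 2 = ∑ m ∈ Finset.Icc 1 M, ((m : ℝ))⁻¹ := by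
      refine Finset.sum_congr rfl fun m hm => ?_
      have hm0 : (0 : ℝ) ≤ (m : ℝ) := by positivity
      rw [inv_pow, Real.sq_sqrt hm0]
    rw [hsq] at hcs
    calc ‖Aminus‖ ^ 2 ≤ (∑ m ∈ Finset.Icc 1 M, ‖a m‖ * (Real.sqrt (m : ℝ))⁻¹) ^ 2 :=
          pow_le_pow_left₀ (norm_nonneg _) hle 2
      _ ≤ (∑ m ∈ Finset.Icc 1 M, ‖a m‖ ^ 2) * ∑ m ∈ Finset.Icc 1 M, ((m : ℝ))⁻¹ := hcs
      _ ≤ (∑ m ∈ Finset.Icc 1 M, ‖a m‖ ^ 2) * (1 + Real.log M) :=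
          mul_le_mul_of_nonneg_left (sum_Icc_inv_le_effWin M) (Finset.sum_nonneg fun _ _ => by positivity)
      _ = (1 + Real.log M) * L := by rw [hL]; ring
  have hnAp2 : ‖Aplus‖ ^ 2 ≤ (M : ℝ) * Q1 := by
    have hle : ‖Aplus‖ ≤ ∑ m ∈ Finset.Icc 1 M, ‖a m‖ * Real.sqrt m * 1 := by
      rw [hAplus]
      refine (norm_sum_le _ _).trans (le_of_eq (Finset.sum_congr rfl fun m hm => ?_))
      rw [norm_mul, Complex.norm_real, Real.norm_eq_abs, abs_of_nonneg (Real.sqrt_nonneg _), mul_one]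
    have hcs := Finset.sum_mul_sq_le_sq_mul_sq (Finset.Icc 1 M) (fun m => ‖a m‖ * Real.sqrt m)
      (fun _ => (1 : ℝ))
    have hsq : ∑ m ∈ Finset.Icc 1 M, (‖a m‖ * Real.sqrt m) ^ 2 = Q1 := by
      rw [hQ1]
      refine Finset.sum_congr rfl fun m hm => ?_
      have hm0 : (0 : ℝ) ≤ m := by positivity
      rw [mul_pow, Real.sq_sqrt hm0]
      ring
    have hone : ∑ _m ∈ Finset.Icc 1 M, (1 : ℝ) ^ 2 = M := by simp
    rw [hsq, hone] at hcs
    calc ‖Aplus‖ ^ 2 ≤ (∑ m ∈ Finset.Icc 1 M, ‖a m‖ * Real.sqrt m * 1) ^ 2 :=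
          pow_le_pow_left₀ (norm_nonneg _) hle 2
      _ ≤ Q1 * M := hcs
      _ = (M : ℝ) * Q1 := by ring
  -- Step 4: `(log M + 1) Q₁ ≤ Q' + M L` (termwise `m(1 + log(M/m)) ≤ M`)
  have hQ1le : (Real.log M + 1) * Q1 ≤ Qp + M * L := by
    rw [hQ1, hQp, hL, Finset.mul_sum, Finset.mul_sum, ← Finset.sum_add_distrib]
    refine Finset.sum_le_sum fun m hm => ?_
    have hm1 : (1 : ℝ) ≤ m := by exact_mod_cast (Finset.mem_Icc.1 hm).1
    have hmM : (m : ℝ) ≤ M := by exact_mod_cast (Finset.mem_Icc.1 hm).2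
    have hm0 : (0 : ℝ) < m := by linarith
    -- `log M − log m ≤ M/m − 1`
    have hlog' : Real.log M - Real.log m ≤ (M : ℝ) / m - 1 := by
      rw [← Real.log_div hMr0.ne' hm0.ne']
      exact Real.log_le_sub_one_of_pos (by positivity)
    have hkey : (m : ℝ) * (Real.log M + 1) ≤ (m : ℝ) * Real.log m + M := by
      have h := mul_le_mul_of_nonneg_left hlog' hm0.le
      have e : (m : ℝ) * ((M : ℝ) / m - 1) = M - m := by field_simp
      rw [e, mul_sub] at h
      linarith
    have ha0 : 0 ≤ ‖a m‖ ^ 2 := by positivity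
    have h' := mul_le_mul_of_nonneg_right hkey ha0
    calc (Real.log M + 1) * ((m : ℝ) * ‖a m‖ ^ 2) = (m : ℝ) * (Real.log M + 1) * ‖a m‖ ^ 2 := by ring
      _ ≤ ((m : ℝ) * Real.log m + M) * ‖a m‖ ^ 2 := h'
      _ = (m : ℝ) * Real.log m * ‖a m‖ ^ 2 + M * ‖a m‖ ^ 2 := by ring
  -- Step 5: split the archimedean Gram form into diagonal and off-diagonal parts
  have hdiagsplit : (weilArchTerm (weilConv (fun x : ℝ => ∑ m ∈ Finset.Icc 1 M,
        a m * ((ε : ℂ)⁻¹ * ((expNegInvGlue (1 - ((x - Real.log (m : ℝ)) / ε) ^ 2) : ℝ) : ℂ)))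
      (weilReflect (fun x : ℝ => ∑ m ∈ Finset.Icc 1 M,
        a m * ((ε : ℂ)⁻¹ * ((expNegInvGlue (1 - ((x - Real.log (m : ℝ)) / ε) ^ 2) : ℝ) : ℂ)))))).re =
      L * Wd + Off := by
    rw [h3]
    have hT0 : ∀ h : ℝ → ℂ, weilTranslate h 0 = h := fun h => funext fun t => by simp [weilTranslate]
    have e : ∀ m ∈ Finset.Icc 1 M,
        ∑ m' ∈ Finset.Icc 1 M, a m * conj (a m') *
            weilArchTerm (weilTranslate ψε (Real.log (m : ℝ) - Real.log (m' : ℝ))) =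
          ((‖a m‖ ^ 2 : ℝ) : ℂ) * weilArchTerm ψε +
            ∑ m' ∈ (Finset.Icc 1 M).erase m, a m * conj (a m') *
              weilArchTerm (weilTranslate ψε (Real.log (m : ℝ) - Real.log (m' : ℝ))) := by
      intro m hm
      rw [← Finset.add_sum_erase _ _ hm, sub_self, hT0, Complex.mul_conj']
      push_cast
      ring
    rw [Finset.sum_congr rfl e, Finset.sum_add_distrib, Complex.add_re, Complex.re_sum]
    congr 1
    rw [hL, Finset.sum_mul]
    refine Finset.sum_congr rfl fun m _ => ?_
    rw [Complex.re_ofReal_mul]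
  -- Step 6: assemble
  have hQ : (weilQuadratic (fun x : ℝ => ∑ m ∈ Finset.Icc 1 M,
        a m * ((ε : ℂ)⁻¹ * ((expNegInvGlue (1 - ((x - Real.log (m : ℝ)) / ε) ^ 2) : ℝ) : ℂ)))).re =
      2 * (weilMellin φε 0 * conj (weilMellin φε 1) * (Aminus * conj Aplus)).re - ε⁻¹ * N * H +
        (L * Wd + Off) := by
    rw [h1, h2, hdiagsplit]
  have hI2r' : I ^ 2 ≤ r * N := hI2r
  exact budget (ε := ε) (Mr := (M : ℝ)) (N := N) (I := I) (L := L) (D := D) (Qp := Qp) (Q1 := Q1)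
    (V := V) (H := H) (Wd := Wd) (Off := Off) (F0 := F0) (F1 := F1) (nAm := ‖Aminus‖) (nAp := ‖Aplus‖)
    hε hMr hlam hNpos hIpos hI2r'
    (Finset.sum_nonneg fun _ _ => by positivity)
    (Finset.sum_nonneg fun _ _ => Finset.sum_nonneg fun _ _ =>
      mul_nonneg ArithmeticFunction.vonMangoldt_nonneg (by positivity))
    (Finset.sum_nonneg fun _ _ => by positivity)
    hQ1le hPoinc hV' hId hQ (norm_nonneg _) hF0le hF1le
    (norm_nonneg _) (norm_nonneg _) hnAm2 hnAp2 hP hbath hOff'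

/-- **EFFECTIVE WINDOW `εM ≤ 1/25`.** For `ε > 0`, `M`, `a` with `εM ≤ 1/25` the fixed-shape comb has
`0 ≤ Re W(g ⋆ g̃)`: `effectiveWindow_of_budget` at `(λ₀, r, G) = (1/25, 2, 3/20)` with `I₀² ≤ 2N`
(`stub_subDiagPole`), `V ≤ (log M + 3/20)L` (`helsonPotential_le_three_twentieths`) and the budget
`assemble_inv25`. -/
theorem combShapePositivity_of_mul_le_inv_25 : ∀ ε : ℝ, 0 < ε → ∀ (M : ℕ) (a : ℕ → ℂ), ε * M ≤ 1 / 25 →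
    0 ≤ (weilQuadratic (fun x : ℝ => ∑ m ∈ Finset.Icc 1 M,
        a m * ((ε : ℂ)⁻¹ * ((expNegInvGlue (1 - ((x - Real.log (m : ℝ)) / ε) ^ 2) : ℝ) : ℂ)))).re :=
  effectiveWindow_of_budget (lam0 := 1 / 25) (r := 2) (G := 3 / 20) (by norm_num) stub_subDiagPole.2.2
    helsonPotential_le_three_twentieths
    (fun hε hMr hlam hN hI hI2 hL hD hQ1 hQ1le hPoinc hV hH hReQ hF1 hF0le hF1le hnAm hnAp hnAm2 hnAp2 hP
        hWd hOff =>
      assemble_inv25 hε hMr hlam hN hI hI2 hL hD hQ1 hQ1le hPoinc hV hH hReQ hF1 hF0le hF1le hnAm hnAp hnAm2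
        hnAp2 hP hWd hOff)

/-- **`stub_windowSub40` — the skeleton's glued sub-theorem (line `Sketch`, skeleton v7), banked.** For `ε > 0`,
`M`, `a` with `εM ≤ 1/40` the fixed-shape comb has `0 ≤ Re W(g ⋆ g̃)` (a special case of
`combShapePositivity_of_mul_le_inv_25`). -/
theorem stub_windowSub40 : ∀ ε : ℝ, 0 < ε → ∀ (M : ℕ) (a : ℕ → ℂ), ε * M ≤ 1 / 40 →
    0 ≤ (weilQuadratic (fun x : ℝ => ∑ m ∈ Finset.Icc 1 M,
        a m * ((ε : ℂ)⁻¹ * ((expNegInvGlue (1 - ((x - Real.log (m : ℝ)) / ε) ^ 2) : ℝ) : ℂ)))).re :=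
  fun ε hε M a hlam => combShapePositivity_of_mul_le_inv_25 ε hε M a (hlam.trans (by norm_num))

/-- **Effective window, cell form.** The cells `(ε, M)` of `WeilComb.CombShapePositivity` with `εM ≤ 1/25` hold
unconditionally (curried alias of `combShapePositivity_of_mul_le_inv_25`). -/
theorem weilQuadratic_shapeComb_re_nonneg_of_mul_le_inv_25 {ε : ℝ} (hε : 0 < ε) {M : ℕ} (a : ℕ → ℂ)
    (h : ε * M ≤ 1 / 25) :
    0 ≤ (weilQuadratic (fun x : ℝ => ∑ m ∈ Finset.Icc 1 M,
        a m * ((ε : ℂ)⁻¹ * ((expNegInvGlue (1 - ((x - Real.log (m : ℝ)) / ε) ^ 2) : ℝ) : ℂ)))).re :=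
  combShapePositivity_of_mul_le_inv_25 ε hε M a h

end Summit.RiemannHypothesis.RiemannHypothesis.Theorems.WeilCombBohrFejer

end
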